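import Literature.AlgebraicTopology.Homotopy.RelativeLiddedCubes
import Literature.AlgebraicTopology.Homotopy.CollaredDeformationRetract
import Mathlib.AlgebraicTopology.FundamentalGroupoid.SimplyConnected
import HarnessLib

/-!
# Lidded cells homotopic as maps of pairs have the same class when `A` is simply connected

Topic `Literature/AlgebraicTopology/Homotopy`, continuing `RelativeLiddedCubes.lean`. There a
*lidded cell* `f : (Iᵐ⁺², ∂Iᵐ⁺², {y₀ = 1}) → (X, A, a)` gets a class
`lidClass f ∈ πₘ₊₂(X, A, a)`, invariant under homotopies **through lidded cells**
(`LiddedCube.lidClass_eq_of_homotopy`). This file proves the stronger invariance that holds when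
`A` is simply connected:

* `LiddedCube.lidClass_eq_of_pairHomotopy` — if `↥A` is simply connected and two lidded cells
  `f`, `g` are homotopic **through maps of pairs `(Iᵐ⁺², ∂Iᵐ⁺²) → (X, A)`** (the lid being allowed
  to move inside `A`), then `lidClass f = lidClass g`.

This is the representative-level form of the classical fact that for `π₁(A, a) = 0` the action
of `π₁(A)` on `πₙ(X, A, a)` is trivial, i.e. `π'ₙ = πₙ` and based relative homotopy classes are
free relative homotopy classes (Spanier, *Algebraic Topology* (1981), Ch. 7 §3, the operation
`h_[ω]` of `π₁(A, x₀)` on `πₙ(X, A, x₀)`, and §4 p. 390: "`π'ₙ(X, A, x₀)` … the quotient group of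
`πₙ(X, A, x₀)` by the normal subgroup generated by `{(h_[ω][α])[α]⁻¹}`"; Hatcher, *Algebraic
Topology* (2002), §4.1 pp. 341–345, the action of `π₁` and its triviality). It is
the input by which devices of relative classes that are only homotopic as maps of pairs are
compared in `Literature/AlgebraicTopology/SingularHomology/` (radial device `relSimplexClass`
versus cone chart `coneClass`).

Proof (collar surgery, everything explicit; `[folklore]`):

* `LiddedCube.collared f` — `f` reparametrised in the lid coordinate `y₀ ↦ min(1, 2y₀)`, so that
  the upper half `{y₀ ≥ ½}` is an `a`-collar; `f ≃ collared f` through lidded cells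
  (`lidClass_collared`);
* `LiddedCube.Surgery.bigK` — from a pair homotopy `H : f ≃ g`, a homotopy **through lidded cells**
  `collared f ≃ collared g`: on `{y₀ ≤ ½}` it is `H` (sped up), and the collar `{y₀ ≥ ½}` is filled
  with a null-homotopy, inside `A`, of the lid track `h(s, y') = H(s, (1, y'))`: first contract the
  lid variable `y'` to the centre of the lid (straight line), which turns `h` into the loop
  `ℓ(s) = H(s, (1, centre))` at `a` in `A`, then kill `ℓ` by a path homotopy in `↥A`
  (`SimplyConnectedSpace.paths_homotopic`).

## References

* E. H. Spanier, *Algebraic Topology*, Springer (1981), Ch. 7 §3 (action of `π₁(A)` on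
  `πₙ(X, A)`), §4 p. 390 (`π'ₙ`). [Spanier1981]
* A. Hatcher, *Algebraic Topology*, CUP (2002), §4.1, pp. 341–345. [HatcherAT2002]
-/

noncomputable section

open scoped unitInterval Topology Topology.Homotopy
open Set Function

universe u

namespace Literature.AlgebraicTopology.Homotopy

namespace LiddedCube

variable {X : Type u} [TopologicalSpace X] {A : Set X} {a : A} {m : ℕ}

/-! ### Coordinates: doubling the lid coordinate, contracting the lid -/

/-- `min(1, 2t)`, clamped. [folklore] -/
def dbl (t : I) : I := clampI (2 * t)

/-- `max(0, 2t - 1)`, clamped. [folklore] -/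
def dbl' (t : I) : I := clampI (2 * t - 1)

/-- `dbl` is continuous. [folklore] -/
lemma continuous_dbl : Continuous dbl := continuous_clampI.comp (by fun_prop)

/-- `dbl'` is continuous. [folklore] -/
lemma continuous_dbl' : Continuous dbl' := continuous_clampI.comp (by fun_prop)

/-- `dbl 0 = 0`. [folklore] -/
@[simp] lemma dbl_zero : dbl 0 = 0 := by rw [dbl, Icc.coe_zero, mul_zero, clampI_zero]

/-- `dbl t = 1` for `t ≥ ½`. [folklore] -/
lemma dbl_of_half_le {t : I} (ht : 1 / 2 ≤ (t : ℝ)) : dbl t = 1 := by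
  unfold dbl; exact clampI_of_one_le (by linarith)

/-- `dbl 1 = 1`. [folklore] -/
@[simp] lemma dbl_one : dbl 1 = 1 := dbl_of_half_le (by rw [Icc.coe_one]; norm_num)

/-- `dbl' t = 0` for `t ≤ ½`. [folklore] -/
lemma dbl'_of_le_half {t : I} (ht : (t : ℝ) ≤ 1 / 2) : dbl' t = 0 := by
  unfold dbl'; exact clampI_of_nonpos (by linarith)

/-- `dbl' 1 = 1`. [folklore] -/
@[simp] lemma dbl'_one : dbl' 1 = 1 := by
  rw [dbl', Icc.coe_one]; exact clampI_of_one_le (by norm_num)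

/-- `dbl t` is extreme when `t` is. [folklore] -/
lemma dbl_isExtreme {t : I} (ht : t = 0 ∨ t = 1) : dbl t = 0 ∨ dbl t = 1 := by
  rcases ht with rfl | rfl
  · exact Or.inl dbl_zero
  · exact Or.inr dbl_one

/-- The lid variable contracted towards the centre of the lid: `(1 - λ) y' + λ · ½`. [folklore] -/
def cent (l : I) (y' : Fin (m + 1) → I) : Fin (m + 1) → I := fun i => clampI ((1 - l) * y' i + l * (1 / 2))

/-- `cent` is jointly continuous. [folklore] -/
lemma continuous_cent : Continuous fun q : I × (Fin (m + 1) → I) => cent q.1 q.2 :=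
  continuous_pi fun i => continuous_clampI.comp (by fun_prop)

/-- `cent 0 = id`. [folklore] -/
@[simp] lemma cent_zero (y' : Fin (m + 1) → I) : cent 0 y' = y' := by
  funext i
  rw [cent, Icc.coe_zero]
  have : (1 - 0) * (y' i : ℝ) + 0 * (1 / 2) = y' i := by ring
  rw [this, clampI_coe]

variable (m) in
/-- The centre of the lid. [folklore] -/
def centre : Fin (m + 1) → I := fun _ => clampI (1 / 2)

/-- `cent 1 y' = centre`. [folklore] -/
@[simp] lemma cent_one (y' : Fin (m + 1) → I) : cent 1 y' = centre m := by
  funext i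
  rw [cent, centre, Icc.coe_one]
  congr 1; ring

/-! ### `Fin.cons` and `Fin.tail` bookkeeping -/

/-- `(t, y') ↦ Fin.cons t y'` is continuous. [folklore] -/
lemma continuous_cons₂ : Continuous fun q : I × (Fin (m + 1) → I) => (Fin.cons q.1 q.2 : Fin (m + 2) → I) :=
  continuous_pi fun i => Fin.cases (by simp only [Fin.cons_zero]; fun_prop)
    (fun k => by simp only [Fin.cons_succ]; fun_prop) i

/-- `Fin.tail` is continuous. [folklore] -/
lemma continuous_tail : Continuous fun y : Fin (m + 2) → I => Fin.tail y :=
  continuous_pi fun _ => continuous_apply _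

/-- `Fin.cons t (Fin.tail y)` lies on `∂Iᵐ⁺²` if `y` does and `t` is extreme whenever `y 0` is.
[folklore] -/
lemma cons_tail_mem_boundary {y : Fin (m + 2) → I} (hy : y ∈ Cube.boundary (Fin (m + 2))) {t : I}
    (ht : (y 0 = 0 ∨ y 0 = 1) → (t = 0 ∨ t = 1)) :
    (Fin.cons t (Fin.tail y) : Fin (m + 2) → I) ∈ Cube.boundary (Fin (m + 2)) := by
  obtain ⟨i, hi⟩ := hy
  cases i using Fin.cases with
  | zero => exact ⟨0, by rw [Fin.cons_zero]; exact ht hi⟩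
  | succ k => exact ⟨k.succ, by rw [Fin.cons_succ]; exact hi⟩

/-- `Fin.cons 1 y'` lies on `∂Iᵐ⁺²`. [folklore] -/
lemma cons_one_mem_boundary (y' : Fin (m + 1) → I) :
    (Fin.cons 1 y' : Fin (m + 2) → I) ∈ Cube.boundary (Fin (m + 2)) :=
  ⟨0, Or.inr (Fin.cons_zero _ _)⟩

/-! ### The collared cell -/

/-- **The collared cell** `f♯(y) = f(min(1, 2y₀), y')`: `f` sped up in the lid coordinate, constant
`= f(1, y') = a` on the collar `{y₀ ≥ ½}`. [folklore] -/
def collared (f : C((Fin (m + 2) → I), X)) : C((Fin (m + 2) → I), X) where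
  toFun y := f (Fin.cons (dbl (y 0)) (Fin.tail y))
  continuous_toFun := f.continuous.comp (continuous_cons₂.comp
    ((continuous_dbl.comp (continuous_apply 0)).prodMk continuous_tail))

/-- `collared f` pointwise. [folklore] -/
@[simp] lemma collared_apply (f : C((Fin (m + 2) → I), X)) (y : Fin (m + 2) → I) :
    collared f y = f (Fin.cons (dbl (y 0)) (Fin.tail y)) := rfl

/-- The collared cell of a lidded cell is lidded. [folklore] -/
lemma collared_mem {f : C((Fin (m + 2) → I), X)} (hf : f ∈ LidCell A a m) : collared f ∈ LidCell A a m := by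
  refine ⟨fun y hy => ?_, fun y hy => ?_⟩
  · rw [collared_apply, hy, dbl_one]
    exact hf.1 _ (Fin.cons_zero _ _)
  · rw [collared_apply]
    exact hf.2 _ (cons_tail_mem_boundary hy dbl_isExtreme)

/-- On the collar `{y₀ ≥ ½}` the collared cell of a lidded cell is `a`. [folklore] -/
lemma collared_apply_of_half_le {f : C((Fin (m + 2) → I), X)} (hf : f ∈ LidCell A a m)
    {y : Fin (m + 2) → I} (hy : 1 / 2 ≤ (y 0 : ℝ)) : collared f y = a := by
  rw [collared_apply, dbl_of_half_le hy]
  exact hf.1 _ (Fin.cons_zero _ _)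

/-- The homotopy `f ≃ collared f`: speed up the lid coordinate by the factor `1 + λ`. [folklore] -/
def collarHtpy (f : C((Fin (m + 2) → I), X)) : C(I × (Fin (m + 2) → I), X) where
  toFun q := f (Fin.cons (clampI ((1 + q.1) * q.2 0)) (Fin.tail q.2))
  continuous_toFun := f.continuous.comp (continuous_cons₂.comp
    ((continuous_clampI.comp (by fun_prop)).prodMk (continuous_tail.comp continuous_snd)))

/-- `collarHtpy` at `λ = 0` is `f`. [folklore] -/
lemma collarHtpy_zero (f : C((Fin (m + 2) → I), X)) (y : Fin (m + 2) → I) : collarHtpy f (0, y) = f y := by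
  change f (Fin.cons (clampI ((1 + ((0 : I) : ℝ)) * y 0)) (Fin.tail y)) = f y
  have : (1 + ((0 : I) : ℝ)) * y 0 = y 0 := by rw [Icc.coe_zero]; ring
  rw [this, clampI_coe, Fin.cons_self_tail]

/-- `collarHtpy` at `λ = 1` is `collared f`. [folklore] -/
lemma collarHtpy_one (f : C((Fin (m + 2) → I), X)) (y : Fin (m + 2) → I) :
    collarHtpy f (1, y) = collared f y := by
  change f (Fin.cons (clampI ((1 + ((1 : I) : ℝ)) * y 0)) (Fin.tail y)) = f (Fin.cons (dbl (y 0)) (Fin.tail y))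
  have : (1 + ((1 : I) : ℝ)) * y 0 = 2 * y 0 := by rw [Icc.coe_one]; ring
  rw [this]; rfl

/-- Every level of `collarHtpy` is a lidded cell. [folklore] -/
lemma collarHtpy_mem {f : C((Fin (m + 2) → I), X)} (hf : f ∈ LidCell A a m) (l : I) :
    (collarHtpy f).curry l ∈ LidCell A a m := by
  have hl : (0 : ℝ) ≤ l := l.2.1
  refine ⟨fun y hy => ?_, fun y hy => ?_⟩
  · change f (Fin.cons (clampI ((1 + (l : ℝ)) * y 0)) (Fin.tail y)) = a
    rw [hy, Icc.coe_one, mul_one, clampI_of_one_le (by linarith)]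
    exact hf.1 _ (Fin.cons_zero _ _)
  · change f (Fin.cons (clampI ((1 + (l : ℝ)) * y 0)) (Fin.tail y)) ∈ A
    refine hf.2 _ (cons_tail_mem_boundary hy fun h => ?_)
    rcases h with h | h
    · left; rw [h, Icc.coe_zero, mul_zero, clampI_zero]
    · right; rw [h, Icc.coe_one, mul_one]; exact clampI_of_one_le (by linarith)

/-- **`lidClass f = lidClass (collared f)`.** [folklore] -/
theorem lidClass_collared {f : C((Fin (m + 2) → I), X)} (hf : f ∈ LidCell A a m) :
    lidClass f hf = lidClass (collared f) (collared_mem hf) :=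
  lidClass_eq_of_homotopy hf (collared_mem hf) (collarHtpy f) (collarHtpy_zero f) (collarHtpy_one f)
    (collarHtpy_mem hf)

/-! ### The surgery on the collar -/

namespace Surgery

variable {f g : C((Fin (m + 2) → I), X)} (hf : f ∈ LidCell A a m)
  (hg : g ∈ LidCell A a m) (H : C(I × (Fin (m + 2) → I), X)) (hH0 : ∀ y, H (0, y) = f y)
  (hH1 : ∀ y, H (1, y) = g y) (hH : ∀ (s : I), ∀ y ∈ Cube.boundary (Fin (m + 2)), H (s, y) ∈ A)

include hH in
/-- The lid track `h(s, y') = H(s, (1, y'))` runs inside `A`. [folklore] -/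
lemma track_mem (s : I) (y' : Fin (m + 1) → I) : H (s, Fin.cons 1 y') ∈ A :=
  hH s _ (cons_one_mem_boundary y')

/-- **The loop `ℓ(s) = H(s, (1, centre))` at `a` in `↥A`** traced by the centre of the lid. [folklore] -/
def loopA : Path a a where
  toFun s := ⟨H (s, Fin.cons 1 (centre m)), track_mem H hH s _⟩
  continuous_toFun := (H.continuous.comp (continuous_id.prodMk continuous_const)).subtype_mk _
  source' := Subtype.ext (by
    change H (0, Fin.cons 1 (centre m)) = a
    rw [hH0]; exact hf.1 _ (Fin.cons_zero _ _))
  target' := Subtype.ext (by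
    change H (1, Fin.cons 1 (centre m)) = a
    rw [hH1]; exact hg.1 _ (Fin.cons_zero _ _))

/-- `loopA` pointwise. [folklore] -/
lemma loopA_apply (s : I) : ((loopA hf hg H hH0 hH1 hH s : A) : X) = H (s, Fin.cons 1 (centre m)) := rfl

variable [SimplyConnectedSpace A]

/-- **A null-homotopy of `ℓ` inside `A`** (rel end points), by simple connectivity of `↥A`. [folklore] -/
def nullHtpy : Path.Homotopy (loopA hf hg H hH0 hH1 hH) (Path.refl a) :=
  (SimplyConnectedSpace.paths_homotopic _ _).some

/-- The null-homotopy read in `X`: `N(v, s)`. [folklore] -/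
def nFun (q : I × I) : X := ((nullHtpy hf hg H hH0 hH1 hH q : A) : X)

/-- `nFun` is continuous. [folklore] -/
lemma continuous_nFun : Continuous (nFun hf hg H hH0 hH1 hH) :=
  continuous_subtype_val.comp (nullHtpy hf hg H hH0 hH1 hH).continuous

/-- `N` lies in `A`. [folklore] -/
lemma nFun_mem (q : I × I) : nFun hf hg H hH0 hH1 hH q ∈ A := (nullHtpy hf hg H hH0 hH1 hH q).2

/-- `N(0, s) = ℓ(s)`. [folklore] -/
lemma nFun_zero (s : I) : nFun hf hg H hH0 hH1 hH (0, s) = H (s, Fin.cons 1 (centre m)) := by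
  rw [nFun, (nullHtpy hf hg H hH0 hH1 hH).apply_zero]; rfl

/-- `N(1, s) = a`. [folklore] -/
lemma nFun_one (s : I) : nFun hf hg H hH0 hH1 hH (1, s) = a := by
  rw [nFun, (nullHtpy hf hg H hH0 hH1 hH).apply_one]; rfl

/-- `N(v, 0) = a`. [folklore] -/
lemma nFun_left_zero (v : I) : nFun hf hg H hH0 hH1 hH (v, 0) = a := by
  rw [nFun, (nullHtpy hf hg H hH0 hH1 hH).source]

/-- `N(v, 1) = a`. [folklore] -/
lemma nFun_left_one (v : I) : nFun hf hg H hH0 hH1 hH (v, 1) = a := by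
  rw [nFun, (nullHtpy hf hg H hH0 hH1 hH).target]

/-- **The filling of the collar** `Γ(s, u, y')`: for `u ≤ ½` the lid track with the lid variable
contracted towards the centre, for `u ≥ ½` the null-homotopy of the central loop. [folklore] -/
def gamma (q : I × I × (Fin (m + 1) → I)) : X :=
  if (q.2.1 : ℝ) ≤ 1 / 2 then H (q.1, Fin.cons 1 (cent (dbl q.2.1) q.2.2))
  else nFun hf hg H hH0 hH1 hH (dbl' q.2.1, q.1)

/-- `Γ` is continuous (the two pieces agree at `u = ½`, where both are `ℓ(s)`). [folklore] -/
lemma continuous_gamma : Continuous (gamma hf hg H hH0 hH1 hH) := by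
  refine Continuous.if_le ?_ ?_ (by fun_prop) continuous_const fun q hq => ?_
  · exact H.continuous.comp (continuous_fst.prodMk (continuous_cons₂.comp (continuous_const.prodMk
      (continuous_cent.comp ((continuous_dbl.comp (continuous_fst.comp continuous_snd)).prodMk
        (continuous_snd.comp continuous_snd))))))
  · exact (continuous_nFun hf hg H hH0 hH1 hH).comp
      ((continuous_dbl'.comp (continuous_fst.comp continuous_snd)).prodMk continuous_fst)
  · have h1 : dbl q.2.1 = 1 := dbl_of_half_le hq.ge
    have h2 : dbl' q.2.1 = 0 := dbl'_of_le_half hq.le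
    rw [h1, cent_one, h2, nFun_zero]

/-- `Γ` lies in `A`. [folklore] -/
lemma gamma_mem (q : I × I × (Fin (m + 1) → I)) : gamma hf hg H hH0 hH1 hH q ∈ A := by
  unfold gamma
  split_ifs
  · exact track_mem H hH _ _
  · exact nFun_mem hf hg H hH0 hH1 hH _

/-- `Γ(s, 1, y') = a` (the lid). [folklore] -/
lemma gamma_one (s : I) (y' : Fin (m + 1) → I) : gamma hf hg H hH0 hH1 hH (s, 1, y') = a := by
  unfold gamma
  rw [if_neg (by simp only [Icc.coe_one]; norm_num), dbl'_one, nFun_one]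

/-- `Γ(0, u, y') = a`. [folklore] -/
lemma gamma_zero_left (u : I) (y' : Fin (m + 1) → I) : gamma hf hg H hH0 hH1 hH (0, u, y') = a := by
  unfold gamma
  split_ifs
  · change H (0, Fin.cons 1 (cent (dbl u) y')) = a
    rw [hH0]; exact hf.1 _ (Fin.cons_zero _ _)
  · exact nFun_left_zero hf hg H hH0 hH1 hH _

/-- `Γ(1, u, y') = a`. [folklore] -/
lemma gamma_one_left (u : I) (y' : Fin (m + 1) → I) : gamma hf hg H hH0 hH1 hH (1, u, y') = a := by
  unfold gamma
  split_ifs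
  · change H (1, Fin.cons 1 (cent (dbl u) y')) = a
    rw [hH1]; exact hg.1 _ (Fin.cons_zero _ _)
  · exact nFun_left_one hf hg H hH0 hH1 hH _

/-- `Γ(s, 0, y') = H(s, (1, y'))`. [folklore] -/
lemma gamma_zero (s : I) (y' : Fin (m + 1) → I) : gamma hf hg H hH0 hH1 hH (s, 0, y') = H (s, Fin.cons 1 y') := by
  unfold gamma
  rw [if_pos (by simp only [Icc.coe_zero]; norm_num)]
  change H (s, Fin.cons 1 (cent (dbl 0) y')) = _
  rw [dbl_zero, cent_zero]

/-- **The homotopy `K : collared f ≃ collared g` through lidded cells**: `H` sped up on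
`{y₀ ≤ ½}`, the filling `Γ` on the collar. [folklore] -/
def bigKFun (q : I × (Fin (m + 2) → I)) : X :=
  if (q.2 0 : ℝ) ≤ 1 / 2 then H (q.1, Fin.cons (dbl (q.2 0)) (Fin.tail q.2))
  else gamma hf hg H hH0 hH1 hH (q.1, dbl' (q.2 0), Fin.tail q.2)

/-- `K` is continuous (the two pieces agree at `y₀ = ½`, where both are `H(s, (1, y'))`). [folklore] -/
lemma continuous_bigKFun : Continuous (bigKFun hf hg H hH0 hH1 hH) := by
  refine Continuous.if_le ?_ ?_ (by fun_prop) continuous_const fun q hq => ?_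
  · exact H.continuous.comp (continuous_fst.prodMk (continuous_cons₂.comp
      ((continuous_dbl.comp ((continuous_apply 0).comp continuous_snd)).prodMk
        (continuous_tail.comp continuous_snd))))
  · exact (continuous_gamma hf hg H hH0 hH1 hH).comp (continuous_fst.prodMk
      ((continuous_dbl'.comp ((continuous_apply 0).comp continuous_snd)).prodMk
        (continuous_tail.comp continuous_snd)))
  · have h1 : dbl (q.2 0) = 1 := dbl_of_half_le hq.ge
    have h2 : dbl' (q.2 0) = 0 := dbl'_of_le_half hq.le
    rw [h1, h2, gamma_zero]

/-- `K` bundled. [folklore] -/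
def bigK : C(I × (Fin (m + 2) → I), X) := ⟨bigKFun hf hg H hH0 hH1 hH, continuous_bigKFun hf hg H hH0 hH1 hH⟩

/-- `K` pointwise. [folklore] -/
lemma bigK_apply (q : I × (Fin (m + 2) → I)) : bigK hf hg H hH0 hH1 hH q = bigKFun hf hg H hH0 hH1 hH q := rfl

/-- `K(0, ·) = collared f`. [folklore] -/
lemma bigK_zero (y : Fin (m + 2) → I) : bigK hf hg H hH0 hH1 hH (0, y) = collared f y := by
  rw [bigK_apply, bigKFun]
  split_ifs with h
  · rw [hH0]; rfl
  · change gamma hf hg H hH0 hH1 hH (0, dbl' (y 0), Fin.tail y) = collared f y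
    rw [gamma_zero_left, collared_apply_of_half_le hf (le_of_lt (not_le.1 h))]

/-- `K(1, ·) = collared g`. [folklore] -/
lemma bigK_one (y : Fin (m + 2) → I) : bigK hf hg H hH0 hH1 hH (1, y) = collared g y := by
  rw [bigK_apply, bigKFun]
  split_ifs with h
  · rw [hH1]; rfl
  · change gamma hf hg H hH0 hH1 hH (1, dbl' (y 0), Fin.tail y) = collared g y
    rw [gamma_one_left, collared_apply_of_half_le hg (le_of_lt (not_le.1 h))]

/-- **Every level of `K` is a lidded cell.** [folklore] -/
lemma bigK_mem (s : I) : (bigK hf hg H hH0 hH1 hH).curry s ∈ LidCell A a m := by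
  refine ⟨fun y hy => ?_, fun y hy => ?_⟩
  · change bigKFun hf hg H hH0 hH1 hH (s, y) = a
    rw [bigKFun, if_neg (by change ¬ ((y 0 : ℝ) ≤ 1 / 2); rw [hy, Icc.coe_one]; norm_num)]
    change gamma hf hg H hH0 hH1 hH (s, dbl' (y 0), Fin.tail y) = a
    rw [hy, dbl'_one, gamma_one]
  · change bigKFun hf hg H hH0 hH1 hH (s, y) ∈ A
    rw [bigKFun]
    split_ifs with h
    · refine hH s _ (cons_tail_mem_boundary hy fun h0 => dbl_isExtreme h0)
    · exact gamma_mem hf hg H hH0 hH1 hH _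

include H hH0 hH1 hH in
/-- `lidClass (collared f) = lidClass (collared g)`. [folklore] -/
theorem lidClass_collared_eq :
    lidClass (collared f) (collared_mem hf) = lidClass (collared g) (collared_mem hg) :=
  lidClass_eq_of_homotopy (collared_mem hf) (collared_mem hg) (bigK hf hg H hH0 hH1 hH)
    (bigK_zero hf hg H hH0 hH1 hH) (bigK_one hf hg H hH0 hH1 hH) (bigK_mem hf hg H hH0 hH1 hH)

end Surgery

/-- **Lidded cells homotopic as maps of pairs `(Iᵐ⁺², ∂Iᵐ⁺²) → (X, A)` have the same class in
`πₘ₊₂(X, A, a)` when `↥A` is simply connected** — the triviality of the action of `π₁(A, a) = 0`,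
i.e. `π'ₙ(X, A, a) = πₙ(X, A, a)` at the level of representatives (Spanier 1981, Ch. 7 §4 p. 390;
Hatcher 2002, §4.1). [cite: Spanier1981, Ch. 7 §4 p. 390] -/
theorem lidClass_eq_of_pairHomotopy [SimplyConnectedSpace A] {f g : C((Fin (m + 2) → I), X)}
    (hf : f ∈ LidCell A a m) (hg : g ∈ LidCell A a m) (H : C(I × (Fin (m + 2) → I), X))
    (hH0 : ∀ y, H (0, y) = f y) (hH1 : ∀ y, H (1, y) = g y)
    (hH : ∀ (s : I), ∀ y ∈ Cube.boundary (Fin (m + 2)), H (s, y) ∈ A) :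
    lidClass f hf = lidClass g hg := by
  rw [lidClass_collared hf, lidClass_collared hg]
  exact Surgery.lidClass_collared_eq hf hg H hH0 hH1 hH

/-- **Relative generalized loops homotopic as maps of pairs are homotopic as relative loops' classes**:
for `↥A` simply connected, two relative generalized loops `(Iᵐ⁺², ∂Iᵐ⁺², J) → (X, A, a)` which are
homotopic through maps of pairs `(Iᵐ⁺², ∂Iᵐ⁺²) → (X, A)` define the same element of
`πₘ₊₂(X, A, a)`. [cite: Spanier1981, Ch. 7 §4 p. 390] -/
theorem _root_.Literature.AlgebraicTopology.Homotopy.RelHomotopyGroup.mk_eq_mk_of_pairHomotopy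
    [SimplyConnectedSpace A] (p q : RelGenLoop (0 : Fin (m + 2)) A a) (H : C(I × (Fin (m + 2) → I), X))
    (hH0 : ∀ y, H (0, y) = p y) (hH1 : ∀ y, H (1, y) = q y)
    (hH : ∀ (s : I), ∀ y ∈ Cube.boundary (Fin (m + 2)), H (s, y) ∈ A) :
    (⟦p⟧ : RelHomotopyGroup.Pi (m + 2) X A a) = ⟦q⟧ := by
  rw [← lidClass_eq_mk p, ← lidClass_eq_mk q]
  exact lidClass_eq_of_pairHomotopy _ _ H hH0 hH1 hH

end LiddedCube

end Literature.AlgebraicTopology.Homotopy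

end
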